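import Literature.IUT.LogThetaLattice.HolomorphicLogShellVolume
import HarnessLib

/-!
# [AbsTopIII] Cor 5.10 (iv)(d), nonarchimedean — the REPAIRED named fact holds at the standard model

S. Mochizuki, *Topics in Absolute Anabelian Geometry III* [MochizukiAbsTopIII2015], kurims manuscript
pagination: Prop 5.8 (iii) p. 139 (the type `(p, f, e, m)` of an MLF `k`, "`p^m` = the order of the subgroup of
`p`-power roots of unity of `k^×`"), Cor 5.10 (iv)(d) p. 148 (the log-volume of the log-shell is the
mono-analytically reconstructed value).

PROOF-ONLY companion (cell abc-iut; referee PASS-F3 finding F18, abc-iut-L4-lead RULING φ (1)(b)): the F18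
successor `MonoAnalyticLogShellVolumeOfType` of abc-iut-L4-t3's `LogShellVolumes.lean` — which binds the fourth
entry `m` of the type through `MLFType.IsTorsionExpOf` — HOLDS at the standard model `PadicLogOnUnits.ofUnitLog p K`
for every numerical type `t` with `t.p = p`, `t.f = f_K`, `t.e = e_K`: the binding clause is abc-iut-S1's
`t.m = torsionPExp p K` by `rfl`, and abc-iut-L6-d2's `monoAnalyticLogShellVolume_ofUnitLog_iff` says the unbound
predicate holds exactly then.  Classical local-field content; nothing here bears on [IUTchIII] Cor. 3.12.
-/

noncomputable section

namespace Literature.IUT.LogThetaLattice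

open Literature.AnabelianGeometry.AbsoluteAnabelian Literature.IUT.LogVolume

variable (p : ℕ) [Fact p.Prime]
variable (K : Type*) [NontriviallyNormedField K] [instK : NormedAlgebra ℚ_[p] K] [IsUltrametricDist K]
  [ProperSpace K]
variable [MeasurableSpace K] [BorelSpace K]

omit [IsUltrametricDist K] [ProperSpace K] [MeasurableSpace K] [BorelSpace K] in
/-- The binding clause `MLFType.IsTorsionExpOf` of the F18 repair is abc-iut-S1's `p`-power torsion exponent:
`t.IsTorsionExpOf K ↔ t.m = torsionPExp p K` (definitionally, for `t.p = p`).
[cite: MochizukiAbsTopIII2015, Prop 5.8 (iii) p. 139] -/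
theorem MLFType.isTorsionExpOf_iff (t : MLFType) (hp : t.p = p) :
    t.IsTorsionExpOf K ↔ t.m = torsionPExp p K := by
  subst hp
  exact Iff.rfl

/-- **[AbsTopIII] Cor 5.10 (iv)(d), nonarchimedean, REPAIRED form (F18) — DISCHARGED at the standard model**:
for the numerical type `t = (p, f_K, e_K, m)` the named fact `MonoAnalyticLogShellVolumeOfType (ofUnitLog p K) t`
holds (its hypothesis forces `m = m_K`, and then abc-iut-L6-d2's `monoAnalyticLogShellVolume_ofUnitLog_iff`
applies). [cite: MochizukiAbsTopIII2015, Cor 5.10 (iv)(d) p. 148] -/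
theorem monoAnalyticLogShellVolumeOfType_ofUnitLog (t : MLFType) (hp : t.p = p)
    (hf : t.f = residueDegree p K) (he : t.e = absRamificationIdx p K) :
    MonoAnalyticLogShellVolumeOfType (PadicLogOnUnits.ofUnitLog p K) t := by
  intro hm
  rw [monoAnalyticLogShellVolume_ofUnitLog_iff p K t hp hf he]
  subst hp
  exact hm

end Literature.IUT.LogThetaLattice

end
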